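import Literature.NumberTheory.Sieve.IwaniecAlmostPrimesProp2Prep
import Literature.NumberTheory.Sieve.IwaniecAlmostPrimesMertens
import Summits.Parity.BatemanHorn.Theorems.SoloInformedChebyshevHooleyRows

/-!
# The model mass benchmark for the Chebyshev–Hooley moduli sequence

Soloist artefact (family `parity`, seat `solo-Parity-informed`, session 3), the benchmark announced
in the docstring of `SoloInformedChebyshevHooleyRows` (there the empty-rows inequality is stated
RELATIVE to the model mass `∑∑ b`).  Here the mass of the Grimmelt–Merikoski model
`b(k) = X·ρ(k)/k` (`ρ = Literature.NumberTheory.Sieve.Iwaniec1978.rho`, the number of roots of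
`ν² + 1 ≡ 0 (mod k)`) is bounded BELOW on boxes of PRIME rows and columns
`𝓡[N] × 𝓡[M]`, `𝓡[N] = {p prime : N < p ≤ N²}`, using only the tree's Mertens theorem for `ρ`
(`RhoMertensStrong_holds`: `∑_{p ≤ t} ρ(p) log p / p = log t + O(1)`) — the range `(N, N²]` is
what makes an `O(1)`-Mertens statement sufficient (no dyadic constant is needed):

* `exists_sum_primeRows_rho_div_ge`: `∑_{p ∈ 𝓡[N]} ρ(p)/p ≥ 1/4` for `N ≥ N₀`;
* `sum_Ioc_inv_le_log`: `∑_{M < m ≤ K} 1/m ≤ log K − log M` (`M ≥ 1`);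
* `primeRows_rowMass_le`: every row `p ∈ 𝓡[N]` of the box has model mass
  `∑_{m ∈ 𝓡[M]} X ρ(mp)/(mp) ≤ 4 X log M / (N + 1)`;
* `exists_primeRows_mass_ge`: the box has model mass `∑∑ X ρ(mp)/(mp) ≥ X/32` for `N, M ≥ N₀`;
* `chebyshevHooley_noTypeII_above` (ABSOLUTE form of `chebyshevHooley_rows_rpow`): for every
  `ε > 0` there are `C_ε ≥ 1` and `N₀` such that for all `X` and all `N, M ≥ N₀` some
  `{0,1}`-coefficient bilinear form in `c_X(k) = #{ℓ ≤ X : k ∣ ℓ² + 1}` minus its model satisfies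
  `|∑_{p ∈ 𝓡[N]} β_p ∑_{m ∈ 𝓡[M]} (c_X(mp) − Xρ(mp)/(mp))| ≥ X/32 − C_ε X (X²+1)^ε · 4X log M/(N+1)`,
  which exceeds `X/64` as soon as `N + 1 ≥ 256 C_ε X (X² + 1)^ε log M`: no Type-II estimate of any
  strength holds for the moduli sequence once the row variable exceeds `X^{1+o(1)}` — the
  hypothesis `M ≤ X` (larger variable at most `X`) of Grimmelt–Merikoski, arXiv:2505.00493,
  Thm 1.5 is necessary up to `X^{o(1)}`, unconditionally and not merely relative to a benchmark.

No new definitions (`𝓡[N]` is local notation for `Nat.primesLE (N^2) \ Nat.primesLE N`).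

References: L. Grimmelt, J. Merikoski, arXiv:2505.00493, Thms 1.4–1.5; H. Iwaniec, Invent. Math.
47 (1978) (the function `ρ`); the seat's PLAN.md §7(b).
-/

namespace Summit.Parity.BatemanHorn.Theorems

open Finset Literature.NumberTheory.Sieve.Iwaniec1978

/-- The prime rows `{p prime : N < p ≤ N²}`. -/
local notation "𝓡[" N "]" => (Nat.primesLE (N ^ 2) \ Nat.primesLE N)

/-! ### The prime rows -/

/-- Membership in the prime rows `𝓡[N] = {p prime : N < p ≤ N²}`. [folklore] -/
theorem mem_primeRows {N p : ℕ} : p ∈ 𝓡[N] ↔ p.Prime ∧ N < p ∧ p ≤ N ^ 2 := by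
  simp only [mem_sdiff, Nat.mem_primesLE, not_and]
  constructor
  · rintro ⟨⟨h1, hp⟩, h2⟩
    exact ⟨hp, by by_contra h; exact h2 (by omega) hp, h1⟩
  · rintro ⟨hp, h1, h2⟩
    exact ⟨⟨h2, hp⟩, fun h ↦ by omega⟩

/-- `primesLE N ⊆ primesLE (N²)`. [folklore] -/
theorem primesLE_subset_primesLE_sq (N : ℕ) : Nat.primesLE N ⊆ Nat.primesLE (N ^ 2) := by
  intro p hp
  rw [Nat.mem_primesLE] at hp ⊢
  exact ⟨hp.1.trans (Nat.le_self_pow two_ne_zero N), hp.2⟩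

/-! ### Mertens for `ρ` on the range `(N, N²]` -/

/-- `rhoLogSum` at a natural number is the sum over `Nat.primesLE n`. [folklore] -/
theorem rhoLogSum_natCast (n : ℕ) :
    rhoLogSum (n : ℝ) = ∑ p ∈ Nat.primesLE n, (rho p : ℝ) * Real.log p / p := by
  rw [rhoLogSum, Nat.floor_natCast]

/-- `∑_{p ∈ 𝓡[N]} ρ(p) log p / p = rhoLogSum (N²) − rhoLogSum N`. [folklore] -/
theorem sum_primeRows_rho_log_div (N : ℕ) :
    ∑ p ∈ 𝓡[N], (rho p : ℝ) * Real.log p / p =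
      rhoLogSum ((N ^ 2 : ℕ) : ℝ) - rhoLogSum (N : ℝ) := by
  rw [rhoLogSum_natCast, rhoLogSum_natCast]
  exact sum_sdiff_eq_sub (primesLE_subset_primesLE_sq N)

/-- **`∑_{N < p ≤ N²} ρ(p)/p ≥ 1/4` for large `N`**, from `RhoMertensStrong_holds`. [folklore] -/
theorem exists_sum_primeRows_rho_div_ge :
    ∃ N₀ : ℕ, ∀ N : ℕ, N₀ ≤ N → (1 / 4 : ℝ) ≤ ∑ p ∈ 𝓡[N], (rho p : ℝ) / p := by
  obtain ⟨C, hC⟩ := RhoMertensStrong_holds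
  refine ⟨⌈Real.exp (4 * C)⌉₊ + 2, fun N hN ↦ ?_⟩
  have hN2 : 2 ≤ N := by omega
  have hlogN : 4 * C ≤ Real.log N := by
    have h : Real.exp (4 * C) ≤ N :=
      (Nat.le_ceil _).trans (by exact_mod_cast (by omega : ⌈Real.exp (4 * C)⌉₊ ≤ N))
    calc 4 * C = Real.log (Real.exp (4 * C)) := (Real.log_exp _).symm
      _ ≤ Real.log N := Real.log_le_log (Real.exp_pos _) h
  have hlogpos : 0 < Real.log N := Real.log_pos (by exact_mod_cast (by omega : 1 < N))
  have h1 := hC (N : ℝ) (by exact_mod_cast (by omega : 1 ≤ N))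
  have h2 := hC ((N ^ 2 : ℕ) : ℝ) (by exact_mod_cast Nat.one_le_pow 2 N (by omega))
  have hlog2 : Real.log ((N ^ 2 : ℕ) : ℝ) = 2 * Real.log N := by
    push_cast
    rw [Real.log_pow]
    norm_num
  have hS : Real.log N - 2 * C ≤ ∑ p ∈ 𝓡[N], (rho p : ℝ) * Real.log p / p := by
    rw [sum_primeRows_rho_log_div]
    rw [abs_le] at h1 h2
    rw [hlog2] at h2
    linarith [h1.2, h2.1]
  have hT : ∑ p ∈ 𝓡[N], (rho p : ℝ) * Real.log p / p ≤
      2 * Real.log N * ∑ p ∈ 𝓡[N], (rho p : ℝ) / p := by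
    rw [mul_sum]
    refine sum_le_sum fun p hp ↦ ?_
    obtain ⟨hpp, -, hpN⟩ := mem_primeRows.mp hp
    have hp0 : (0 : ℝ) < p := by exact_mod_cast hpp.pos
    have hlogp : Real.log p ≤ 2 * Real.log N := by
      rw [← hlog2]
      exact Real.log_le_log hp0 (by exact_mod_cast hpN)
    rw [mul_comm (rho p : ℝ), mul_div_assoc]
    exact mul_le_mul_of_nonneg_right hlogp (div_nonneg (Nat.cast_nonneg _) hp0.le)
  have hle : Real.log N - 2 * C ≤ 2 * Real.log N * ∑ p ∈ 𝓡[N], (rho p : ℝ) / p := hS.trans hT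
  by_contra hlt
  have hlt' := not_le.mp hlt
  have : 2 * Real.log N * ∑ p ∈ 𝓡[N], (rho p : ℝ) / p < 2 * Real.log N * (1 / 4) :=
    mul_lt_mul_of_pos_left hlt' (by linarith)
  linarith

/-! ### Harmonic sums on `(M, K]` -/

/-- `∑_{M < m ≤ K} 1/m ≤ log K − log M` for `1 ≤ M ≤ K`. [folklore] -/
theorem sum_Ioc_inv_le_log {M K : ℕ} (hM : 1 ≤ M) (hMK : M ≤ K) :
    ∑ m ∈ Ioc M K, (1 : ℝ) / m ≤ Real.log K - Real.log M := by
  induction K, hMK using Nat.le_induction with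
  | base => simp
  | succ K hMK ih =>
    rw [sum_Ioc_succ_top hMK]
    push_cast
    have hK0 : (0 : ℝ) < K := by exact_mod_cast (by omega : 0 < K)
    have hterm : (1 : ℝ) / ((K : ℝ) + 1) ≤ Real.log ((K : ℝ) + 1) - Real.log K := by
      have h := Real.one_sub_inv_le_log_of_pos (show (0 : ℝ) < ((K : ℝ) + 1) / K by positivity)
      rw [Real.log_div (by positivity) hK0.ne', inv_div] at h
      have e : (1 : ℝ) - K / (K + 1) = 1 / (K + 1) := by
        field_simp
        ring
      linarith
    linarith

/-- `∑_{m ∈ 𝓡[M]} 1/m ≤ log M` (`M ≥ 1`). [folklore] -/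
theorem sum_primeRows_inv_le_log {M : ℕ} (hM : 1 ≤ M) :
    ∑ m ∈ 𝓡[M], (1 : ℝ) / m ≤ Real.log M := by
  have hsub : 𝓡[M] ⊆ Ioc M (M ^ 2) := by
    intro m hm
    obtain ⟨-, h1, h2⟩ := mem_primeRows.mp hm
    exact mem_Ioc.mpr ⟨h1, h2⟩
  calc ∑ m ∈ 𝓡[M], (1 : ℝ) / m ≤ ∑ m ∈ Ioc M (M ^ 2), (1 : ℝ) / m :=
        sum_le_sum_of_subset_of_nonneg hsub fun m _ _ ↦ by positivity
    _ ≤ Real.log ((M ^ 2 : ℕ) : ℝ) - Real.log M :=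
        sum_Ioc_inv_le_log hM (Nat.le_self_pow two_ne_zero M)
    _ = Real.log M := by push_cast; rw [Real.log_pow]; ring

/-! ### The model `b(k) = X ρ(k)/k` on prime boxes -/

/-- **Row mass.**  For a prime row `p ∈ 𝓡[N]` and prime columns `𝓡[M]` (`M ≥ 1`):
`∑_{m ∈ 𝓡[M]} X ρ(mp)/(mp) ≤ 4 X log M / (N + 1)`. [folklore] -/
theorem primeRows_rowMass_le (X : ℕ) {N M p : ℕ} (hM : 1 ≤ M) (hp : p ∈ 𝓡[N]) :
    ∑ m ∈ 𝓡[M], (X : ℝ) * (rho (m * p) : ℝ) / ((m * p : ℕ) : ℝ) ≤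
      4 * X * Real.log M / (N + 1) := by
  obtain ⟨hpp, hNp, -⟩ := mem_primeRows.mp hp
  have hp1 : (N : ℝ) + 1 ≤ p := by exact_mod_cast hNp
  have hN1 : (0 : ℝ) < N + 1 := by positivity
  have hterm : ∀ m ∈ 𝓡[M], (X : ℝ) * (rho (m * p) : ℝ) / ((m * p : ℕ) : ℝ) ≤
      4 * X / (N + 1) * ((1 : ℝ) / m) := by
    intro m hm
    obtain ⟨hmm, -, -⟩ := mem_primeRows.mp hm
    have hm0 : (0 : ℝ) < m := by exact_mod_cast hmm.pos
    have hp0 : (0 : ℝ) < p := by exact_mod_cast hpp.pos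
    have hρ : (rho (m * p) : ℝ) ≤ 4 := by
      have h4 : rho (m * p) ≤ 4 := by
        by_cases h : m = p
        · rw [h, ← sq]
          exact (rho_primePow_le_two hpp one_le_two).trans (by norm_num)
        · rw [rho_mul_of_coprime hmm.ne_zero hpp.ne_zero ((Nat.coprime_primes hmm hpp).mpr h)]
          exact Nat.mul_le_mul (rho_le_two hmm) (rho_le_two hpp)
      exact_mod_cast h4
    have hX : (0 : ℝ) ≤ X := Nat.cast_nonneg _
    push_cast
    rw [div_le_iff₀ (by positivity), show 4 * (X : ℝ) / (N + 1) * (1 / m) * (m * p) =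
      4 * X * (p / (N + 1)) by field_simp]
    calc (X : ℝ) * rho (m * p) ≤ X * 4 := mul_le_mul_of_nonneg_left hρ hX
      _ = 4 * X * 1 := by ring
      _ ≤ 4 * X * (p / (N + 1)) :=
          mul_le_mul_of_nonneg_left ((one_le_div hN1).mpr hp1) (by positivity)
  calc ∑ m ∈ 𝓡[M], (X : ℝ) * (rho (m * p) : ℝ) / ((m * p : ℕ) : ℝ)
      ≤ ∑ m ∈ 𝓡[M], 4 * X / (N + 1) * ((1 : ℝ) / m) := sum_le_sum hterm
    _ = 4 * X / (N + 1) * ∑ m ∈ 𝓡[M], (1 : ℝ) / m := by rw [mul_sum]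
    _ ≤ 4 * X / (N + 1) * Real.log M :=
        mul_le_mul_of_nonneg_left (sum_primeRows_inv_le_log hM) (by positivity)
    _ = 4 * X * Real.log M / (N + 1) := by ring

/-- **Mass of the model on a prime box.**  There is `N₀` such that for all `X` and all
`N, M ≥ N₀`: `∑_{p ∈ 𝓡[N]} ∑_{m ∈ 𝓡[M]} X ρ(mp)/(mp) ≥ X/32`
(`(∑ ρ(p)/p)(∑ ρ(m)/m) ≥ 1/16` by `exists_sum_primeRows_rho_div_ge` and multiplicativity of `ρ`
off the diagonal; the diagonal `m = p` costs at most `8X/(N+1)`). [folklore] -/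
theorem exists_primeRows_mass_ge :
    ∃ N₀ : ℕ, ∀ X N M : ℕ, N₀ ≤ N → N₀ ≤ M →
      (X : ℝ) / 32 ≤ ∑ p ∈ 𝓡[N], ∑ m ∈ 𝓡[M], (X : ℝ) * (rho (m * p) : ℝ) / ((m * p : ℕ) : ℝ) := by
  obtain ⟨N₁, hN₁⟩ := exists_sum_primeRows_rho_div_ge
  refine ⟨max N₁ 255, fun X N M hN hM ↦ ?_⟩
  have hTN := hN₁ N (le_of_max_le_left hN)
  have hTM := hN₁ M (le_of_max_le_left hM)
  have hN255 : 255 ≤ N := le_of_max_le_right hN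
  have hX : (0 : ℝ) ≤ X := Nat.cast_nonneg _
  -- termwise: off the diagonal the model factorises, on it the term is nonnegative
  have key : ∀ p ∈ 𝓡[N], ∀ m ∈ 𝓡[M],
      (X : ℝ) * ((rho p : ℝ) / p) * ((rho m : ℝ) / m) -
          (if m = p then (X : ℝ) * ((rho p : ℝ) / p) ^ 2 else 0) ≤
        (X : ℝ) * (rho (m * p) : ℝ) / ((m * p : ℕ) : ℝ) := by
    intro p hp m hm
    obtain ⟨hpp, -, -⟩ := mem_primeRows.mp hp
    obtain ⟨hmm, -, -⟩ := mem_primeRows.mp hm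
    have hp0 : (0 : ℝ) < p := by exact_mod_cast hpp.pos
    have hm0 : (0 : ℝ) < m := by exact_mod_cast hmm.pos
    split_ifs with h
    · subst h
      have : (0 : ℝ) ≤ (X : ℝ) * (rho (m * m) : ℝ) / ((m * m : ℕ) : ℝ) := by positivity
      nlinarith [this]
    · rw [rho_mul_of_coprime hmm.ne_zero hpp.ne_zero ((Nat.coprime_primes hmm hpp).mpr h)]
      push_cast
      rw [sub_zero, mul_assoc, div_mul_div_comm, ← mul_div_assoc, mul_comm (rho p : ℝ) (rho m : ℝ),
        mul_comm (p : ℝ) (m : ℝ)]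
  have hsum := sum_le_sum fun p hp ↦ sum_le_sum (key p hp)
  -- evaluate the left-hand side
  have hprod : ∑ p ∈ 𝓡[N], ∑ m ∈ 𝓡[M], (X : ℝ) * ((rho p : ℝ) / p) * ((rho m : ℝ) / m) =
      X * (∑ p ∈ 𝓡[N], (rho p : ℝ) / p) * ∑ m ∈ 𝓡[M], (rho m : ℝ) / m := by
    calc ∑ p ∈ 𝓡[N], ∑ m ∈ 𝓡[M], (X : ℝ) * ((rho p : ℝ) / p) * ((rho m : ℝ) / m)
        = ∑ p ∈ 𝓡[N], (X : ℝ) * ((rho p : ℝ) / p) * ∑ m ∈ 𝓡[M], (rho m : ℝ) / m :=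
          sum_congr rfl fun p _ ↦ (mul_sum _ _ _).symm
      _ = (∑ p ∈ 𝓡[N], (X : ℝ) * ((rho p : ℝ) / p)) * ∑ m ∈ 𝓡[M], (rho m : ℝ) / m :=
          (sum_mul _ _ _).symm
      _ = X * (∑ p ∈ 𝓡[N], (rho p : ℝ) / p) * ∑ m ∈ 𝓡[M], (rho m : ℝ) / m := by
          rw [← mul_sum]
  have hdiag : ∑ p ∈ 𝓡[N], ∑ m ∈ 𝓡[M],
      (if m = p then (X : ℝ) * ((rho p : ℝ) / p) ^ 2 else 0) ≤ 8 * X / (N + 1) := by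
    have h1 : ∀ p ∈ 𝓡[N], ∑ m ∈ 𝓡[M], (if m = p then (X : ℝ) * ((rho p : ℝ) / p) ^ 2 else 0)
        ≤ X * (4 * ((p : ℝ) ^ 2)⁻¹) := by
      intro p hp
      obtain ⟨hpp, -, -⟩ := mem_primeRows.mp hp
      have hp0 : (0 : ℝ) < p := by exact_mod_cast hpp.pos
      have hρ : (rho p : ℝ) ≤ 2 := by exact_mod_cast rho_le_two hpp
      have hρ0 : (0 : ℝ) ≤ rho p := Nat.cast_nonneg _
      have hsq : ((rho p : ℝ) / p) ^ 2 ≤ 4 * ((p : ℝ) ^ 2)⁻¹ := by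
        rw [div_pow, div_eq_mul_inv]
        exact mul_le_mul_of_nonneg_right (by nlinarith) (by positivity)
      rw [sum_ite_eq']
      split_ifs
      · exact mul_le_mul_of_nonneg_left hsq hX
      · positivity
    have h2 : ∑ p ∈ 𝓡[N], ((p : ℝ) ^ 2)⁻¹ ≤ 2 / (N + 1) := by
      have hsub : 𝓡[N] ⊆ Ioo N (N ^ 2 + 1) := by
        intro p hp
        obtain ⟨-, h1, h2⟩ := mem_primeRows.mp hp
        exact mem_Ioo.mpr ⟨h1, by omega⟩
      calc ∑ p ∈ 𝓡[N], ((p : ℝ) ^ 2)⁻¹ ≤ ∑ p ∈ Ioo N (N ^ 2 + 1), ((p : ℝ) ^ 2)⁻¹ :=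
            sum_le_sum_of_subset_of_nonneg hsub fun p _ _ ↦ by positivity
        _ ≤ 2 / (N + 1) := sum_Ioo_inv_sq_le N (N ^ 2 + 1)
    calc ∑ p ∈ 𝓡[N], ∑ m ∈ 𝓡[M], (if m = p then (X : ℝ) * ((rho p : ℝ) / p) ^ 2 else 0)
        ≤ ∑ p ∈ 𝓡[N], X * (4 * ((p : ℝ) ^ 2)⁻¹) := sum_le_sum h1
      _ = 4 * X * ∑ p ∈ 𝓡[N], ((p : ℝ) ^ 2)⁻¹ := by rw [mul_sum]; exact sum_congr rfl fun _ _ ↦ by ring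
      _ ≤ 4 * X * (2 / (N + 1)) := mul_le_mul_of_nonneg_left h2 (by positivity)
      _ = 8 * X / (N + 1) := by ring
  simp only [sum_sub_distrib] at hsum
  have hN1 : (256 : ℝ) ≤ N + 1 := by exact_mod_cast (by omega : 256 ≤ N + 1)
  have hdiag' : 8 * (X : ℝ) / (N + 1) ≤ X / 32 := by
    rw [div_le_div_iff₀ (by positivity) (by norm_num)]
    nlinarith
  have hmain : (X : ℝ) / 16 ≤ X * (∑ p ∈ 𝓡[N], (rho p : ℝ) / p) * ∑ m ∈ 𝓡[M], (rho m : ℝ) / m := by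
    have := mul_le_mul hTN hTM (by norm_num) ((by norm_num : (0:ℝ) ≤ 1 / 4).trans hTN)
    nlinarith [this]
  linarith [hsum, hprod, hdiag, hdiag', hmain]

/-! ### Absolute form of the empty-rows inequality -/

/-- **No Type-II information above `X^{1+o(1)}`, unconditionally.**  For every `ε > 0` there
are `C_ε ≥ 1` and `N₀` such that for all `X` and all `N, M ≥ N₀` some `{0,1}`-coefficient
bilinear form satisfies `|∑_{p ∈ 𝓡[N]} β_p ∑_{m ∈ 𝓡[M]} (c_X(mp) − Xρ(mp)/(mp))| ≥
X/32 − C_ε X (X²+1)^ε · 4 X log M/(N+1)`; the right-hand side is `≥ X/64` once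
`N + 1 ≥ 256 C_ε X (X²+1)^ε log M`.  (Combination of `chebyshevHooley_rows_rpow` with the
benchmark `exists_primeRows_mass_ge` and the row bound `primeRows_rowMass_le`.) [folklore] -/
theorem chebyshevHooley_noTypeII_above {ε : ℝ} (hε : 0 < ε) :
    ∃ Cε : ℝ, 1 ≤ Cε ∧ ∃ N₀ : ℕ, ∀ X N M : ℕ, N₀ ≤ N → N₀ ≤ M →
      ∃ β : ℕ → ℝ, (∀ n, β n = 0 ∨ β n = 1) ∧
        (X : ℝ) / 32 - Cε * X * ((X : ℝ) ^ 2 + 1) ^ ε * (4 * X * Real.log M / (N + 1)) ≤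
          |∑ p ∈ 𝓡[N], β p * ∑ m ∈ 𝓡[M],
            (((#((Icc 1 X).filter (fun ℓ : ℕ => m * p ∣ ℓ ^ 2 + 1)) : ℝ)) -
              (X : ℝ) * (rho (m * p) : ℝ) / ((m * p : ℕ) : ℝ))| := by
  obtain ⟨Cε, hC1, hC⟩ := chebyshevHooley_rows_rpow hε
  obtain ⟨N₀, hN₀⟩ := exists_primeRows_mass_ge
  refine ⟨Cε, hC1, max N₀ 1, fun X N M hN hM ↦ ?_⟩
  have hM1 : 1 ≤ M := le_of_max_le_right hM
  have hmass := hN₀ X N M (le_of_max_le_left hN) (le_of_max_le_left hM)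
  have hρ0 : (0 : ℝ) ≤ 4 * X * Real.log M / (N + 1) := by
    have : (0 : ℝ) ≤ Real.log M := Real.log_nonneg (by exact_mod_cast hM1)
    positivity
  obtain ⟨β, hβ, hineq⟩ := hC X 𝓡[N] 𝓡[M]
    (fun k : ℕ ↦ (X : ℝ) * (rho k : ℝ) / (k : ℝ))
    (fun n _ m _ ↦ by positivity) hρ0
    (fun p hp ↦ primeRows_rowMass_le X hM1 hp)
  refine ⟨β, hβ, ?_⟩
  exact le_trans (by linarith) hineq

end Summit.Parity.BatemanHorn.Theorems
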